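import Literature.AlgebraicGeometry.HodgeTheory.RealMultiplicationRelDimTwoPowersHodgeClasses
import HarnessLib

/-!
# Hodge classes on abelian varieties with slots over `A`, when `End_Hdg(H¹(A)) ⊗ ℂ` is diagonalised by REAL characters with FOUR-dimensional blocks carrying Hodge–Darboux bases with rational `θ`-classes, are generated by divisor classes — the Lie step and the assembly with `End⁰(A)` NOT assumed to be a field (Moonen–Zarhin 1995 Type I(2); Murty 1984 §3; Hazama 1983/1989)

Family `hodge`, layer `Literature/AlgebraicGeometry/HodgeTheory`. Research context: cell `pub-hodge-ring2`
(HONEST FRAMING: research route conditional on HC_CM; not a corollary; Q11.4-sentence-2 already refuted in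
dim ≥ 3), Literature lane gen 70, programme R47 (heir H1b′: products of relative-dimension-two real-multiplication
varieties). This file is the tree's `RealMultiplicationRelDimTwoPowersLieInvariance` §2 / `RealMultiplicationRelDimTwoPowersHodgeClasses`
§2 (`AVSlots.exists_rm2Invariant_coeff`, `AVSlots.rm2HodgeClasses_divisorial`) with the hypothesis «`End⁰(A)` is a totally
real FIELD `F` with `2[F:ℚ] = dim A`» replaced by its abstract consequences used in the proof — exactly as the tree's
`RealCharactersSlotsHodgeClasses` does for relative dimension one: a family of REAL characters `σ_τ` of `End_Hdg(H¹(A))`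
whose eigenblocks form an internal direct sum with four-dimensional blocks, a polarization `ψ` for which `End_Hdg(H¹(A))`
is self-adjoint, Hodge–Darboux bases `b_τ = (b₀, b₁ ∈ H^{1,0}; b₂, b₃ ∈ H^{0,1})` of the blocks (`ψ_ℂ(b₀,b₂) = ψ_ℂ(b₁,b₃) = 1`,
the other pairings `0`), and the symplectic classes `ρ(b₀) ⌣ ρ(b₂) + ρ(b₁) ⌣ ρ(b₃) ∈ B¹(A) ⊗ ℂ`. This is the form
stable under orthogonal products (`End⁰(A₁ × A₂) = F₁ × F₂` is not a field). UNCONDITIONAL; theorems only (no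
definition, no named fact; D-0026); no step towards a summit statement beyond the published theorems it re-assembles.

PUBLISHED STATEMENTS. Moonen–Zarhin, Duke Math. J. 77 (1995), Type I(2): `Hg = R_{F/ℚ} Sp_{4,F} = Lf`, `B• = D•`;
Murty, Math. Ann. 268 (1984) §3 (Gordon Prop. 7.7.1); Hazama, Tôhoku Math. J. 35 (1983) §3 and Duke Math. J.
58 (1989) (products); Ribet, Amer. J. Math. 105 (1983) Thm. 0 (`Hg = Lf ⟹ Hdg(Aⁿ) = Div(Aⁿ)`).

MAIN RESULTS.
* §1 `AVSlots.exists_sp4Invariant_coeff_of_real_characters` — the invariance theorem (slices of a presentation of a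
  rational `(p,p)`-class on `B` are killed by `𝔰𝔭(V_τ)` placed at place `τ`), for a family of real characters with
  four-dimensional blocks (proof verbatim the field case; the Lie input `SpBlocksTheta.exists_mem_spanC_supported` is
  already stated for a family of characters).
* §2 `AVSlots.hodgeClasses_divisorial_of_sp4BlockBasis` — `B•(B) ⊆ D•(B) ⊗ ℂ` from the data above;
  `AVSlots.isDivisorGenerated_of_sp4BlockBasis`. The field case `AVSlots.rm2HodgeClasses_divisorial` is recovered with
  `σ = hodgeCharacter`, `exists_hodgeDarboux_blockBasis_four`, `thetaFour_mem_span_rational_oneOne`.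

## References

* [MoonenZarhin1995Duke] B. Moonen, Yu. Zarhin, *Hodge classes and Tate classes on simple abelian fourfolds*, Duke
  Math. J. 77 (1995), Type I(2). [cite: MoonenZarhin1995Duke, Type I(2)]
* [Murty1984] V. K. Murty, *Exceptional Hodge classes on certain abelian varieties*, Math. Ann. 268 (1984), §3.
  [cite: Murty1984, §3]
* [Hazama1983] F. Hazama, *Algebraic cycles on abelian varieties with many real endomorphisms*, Tôhoku Math. J. 35
  (1983) 303–308, Thm. (1.1), §3. [cite: Hazama1983, §3 (pp. 305–306)]
* [Hazama1989] F. Hazama, Duke Math. J. 58 (1989) 31–37. [cite: Hazama1989, Thm. (= Gordon 7.6.2)]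
* [Ribet1983] K. A. Ribet, Amer. J. Math. 105 (1983), Thm. 0. [cite: Ribet1983, Thm. 0]
* [Deligne1982HodgeCycles] P. Deligne, LNM 900, I §3. [cite: Deligne1982HodgeCycles, I §3 (proof of Prop. 3.4)]
-/

noncomputable section

open scoped TensorProduct Matrix
open CategoryTheory Module NumberField

namespace Literature.AlgebraicGeometry.HodgeTheory

open Literature.AlgebraicTopology.SingularHomology
open Literature.AlgebraicGeometry.Motives (IsSmoothProjective AbelianVariety bettiCohomology
  ofRatClassBaseChange ofRatClassBaseChange_tmul HodgeTensorFacts hodgeTensorFacts_holds)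
open Literature.Barriers.HodgeConjecture
open Literature.AlgebraicGeometry.Motives.HodgeStructure
open Literature.AlgebraicGeometry.ComplexMultiplication
open Literature.RepresentationTheory.GeneralLinear
open Literature.RepresentationTheory.ClassicalInvariants
open Literature.NumberTheory.DiophantineGeometry


variable {A B : AbelianVariety ℂ} {n : ℕ} {g : Fin n → (B ⟶ A)}

/-! ### §1 The invariance theorem for a family of real characters with four-dimensional blocks -/

/-- The two elements of `Fin 2`. [folklore] -/
private theorem fin2_eq_zero_or_one' (r : Fin 2) : r = 0 ∨ r = 1 := by
  fin_cases r <;> simp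

open scoped Classical in
/-- **The INVARIANCE THEOREM for a family of real characters with four-dimensional blocks (Moonen–Zarhin Type
I(2) / Murty 1984 §3 / Hazama, Lie step, for abelian varieties with slots over `A`).** Let `A` be a complex abelian
variety, `ψ` a polarization of `H¹(A(ℂ); ℚ)` for which `End_Hdg(H¹)` is self-adjoint, `σ_τ` (`τ ∈ T`) REAL characters
of `End_Hdg(H¹(A))` whose eigenblocks `V_τ` give `H¹(A) ⊗ ℂ = ⊕_τ V_τ` with `dim V_τ = 4`, `b_τ` bases of the `V_τ`
adapted to the Hodge decomposition through the kind map `kd`, and `B` an abelian variety with slots `g` over `A`.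
Then every rational class `c` of type `(p,p)` on `B` (`p ≥ 1`) is `∑_w a(w) · (g b)_w` for a coefficient function
`a` such that for every slot-and-place word `U`, every place `τ` and every `ψ_ℂ|_{V_τ}`-skew endomorphism `f` of
`V_τ`, the matrix of `f` in `b_τ` placed at the positions of place `τ` kills the slice `a(U, −)`. The tree's
`AVSlots.exists_rm2Invariant_coeff` is the case `T = (F →+* ℂ)`, `σ = hodgeCharacter` of a totally real field
`F = End⁰(A)` with `2[F:ℚ] = dim A`; the proof is the same (`SpBlocksTheta.exists_mem_spanC_supported` is stated for
a family of characters). [cite: MoonenZarhin1995Duke, Type I(2)] [cite: Murty1984, §3]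
[cite: Hazama1983, §3 (pp. 305–306)] [cite: Ribet1983, Thm. 0] [cite: Deligne1982HodgeCycles, I §3 (proof of Prop. 3.4)] -/
theorem AVSlots.exists_sp4Invariant_coeff_of_real_characters [HodgeTensorFacts.{0, 0}] (hg : AVSlots A B g)
    (hHD : exists_isReal_hodgeModel) (hI : hodgePQ_independent_of_hodgeModel)
    {T : Type} [Fintype T] [DecidableEq T]
    (ψ : (BettiUniverse.hodge hHD (AbelianVariety.isSmoothProjective_holds (A := A)) 1).Polarization)
    (hself : ∀ a : (BettiUniverse.hodge hHD (AbelianVariety.isSmoothProjective_holds (A := A)) 1).endAlg,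
      LinearMap.IsAdjointPair ψ.form ψ.form (a : Module.End ℚ (bettiCohomology A.X 1))
        (a : Module.End ℚ (bettiCohomology A.X 1)))
    (σ : T → ((BettiUniverse.hodge hHD (AbelianVariety.isSmoothProjective_holds (A := A)) 1).endAlg →+* ℂ))
    (hreal : ∀ τ, (starRingEnd ℂ).comp (σ τ) = σ τ)
    (hint : DirectSum.IsInternal fun τ =>
      (BettiUniverse.hodge hHD (AbelianVariety.isSmoothProjective_holds (A := A)) 1).eigenBlock (σ τ))
    (h4 : ∀ τ, Module.finrank ℂ
      ((BettiUniverse.hodge hHD (AbelianVariety.isSmoothProjective_holds (A := A)) 1).eigenBlock (σ τ)) = 4)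
    (b : ∀ τ : T, Module.Basis (Fin 4) ℂ
      ((BettiUniverse.hodge hHD (AbelianVariety.isSmoothProjective_holds (A := A)) 1).eigenBlock
        (σ τ)))
    (kd : Fin 4 → Fin 2)
    (hb0 : ∀ τ r, kd r = 0 → (b τ r : ℂ ⊗[ℚ] bettiCohomology A.X 1) ∈
      (BettiUniverse.hodge hHD (AbelianVariety.isSmoothProjective_holds (A := A)) 1).piece 1 0)
    (hb1 : ∀ τ r, kd r = 1 → (b τ r : ℂ ⊗[ℚ] bettiCohomology A.X 1) ∈
      (BettiUniverse.hodge hHD (AbelianVariety.isSmoothProjective_holds (A := A)) 1).piece 0 1)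
    {p : ℕ} (hp : 0 < p) {c : complexBetti B.X (2 * p)} (hcQ : IsRationalClass c)
    (hc : IsOfHodgeType B.dim B.X (2 * p) p p c) :
    ∃ a : (Fin (2 * p) → (Fin n × T) × Fin 4) → ℂ,
      wordEval (cupPowOneAlt ℂ (Motives.ComplexPoints B.X) (2 * p))
        (fun jr : (Fin n × T) × Fin 4 => complexBetti.map (g jr.1.1).hom.hom.hom 1
          (ofRatClassBaseChange (Motives.ComplexPoints A.X) 1
            (b jr.1.2 jr.2 : ℂ ⊗[ℚ] bettiCohomology A.X 1))) a = c ∧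
      ∀ (U : Fin (2 * p) → Fin n × T) (τ : T)
        (f : Module.End ℂ ↥((BettiUniverse.hodge hHD (AbelianVariety.isSmoothProjective_holds (A := A)) 1).eigenBlock
          (σ τ))),
        (∀ x y : (BettiUniverse.hodge hHD (AbelianVariety.isSmoothProjective_holds (A := A)) 1).eigenBlock
            (σ τ),
          ψ.form.baseChange ℂ ((f x : _) : ℂ ⊗[ℚ] bettiCohomology A.X 1) y +
            ψ.form.baseChange ℂ (x : ℂ ⊗[ℚ] bettiCohomology A.X 1) ((f y : _) : ℂ ⊗[ℚ] bettiCohomology A.X 1) = 0) →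
        wordDerAt ℂ (fun t => if (U t).2 = τ then LinearMap.toMatrix (b τ) (b τ) f else 0)
          (wordSlice a U) = 0 := by
  classical
  -- the setting
  have hX : IsSmoothProjective A.dim A.X := AbelianVariety.isSmoothProjective_holds
  haveI : Module.Finite ℚ (bettiCohomology A.X 1) := finite_bettiCohomology_one A
  have heff : (BettiUniverse.hodge hHD hX 1).IsEffective := BettiUniverse.hodge_isEffective hHD hX 1
  set F := cupPowOneAlt ℂ (Motives.ComplexPoints B.X) (2 * p) with hFdef
  have hFinj : Function.Injective (exteriorPower.alternatingMapLinearEquiv F) :=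
    injective_alternatingMapLinearEquiv_cupPowOneAlt B (2 * p)
  -- bases: the block basis `cbσ` and the rational basis `eC`, both indexed by `Fin M`
  set cbx : Module.Basis (T × Fin 4) ℂ (ℂ ⊗[ℚ] bettiCohomology A.X 1) :=
    (hint.collectedBasis b).reindex (Equiv.sigmaEquivProd T (Fin 4)) with hcbxdef
  set eQ := Module.finBasis ℚ (bettiCohomology A.X 1) with heQ
  set eC : Module.Basis (Fin (Module.finrank ℚ (bettiCohomology A.X 1))) ℂ
    (ℂ ⊗[ℚ] bettiCohomology A.X 1) := Algebra.TensorProduct.basis ℂ eQ with heC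
  set φ : Fin (Module.finrank ℚ (bettiCohomology A.X 1)) ≃ T × Fin 4 :=
    eC.indexEquiv cbx with hφ
  set cbσ : Module.Basis (Fin (Module.finrank ℚ (bettiCohomology A.X 1))) ℂ
    (ℂ ⊗[ℚ] bettiCohomology A.X 1) := cbx.reindex φ.symm with hcbσdef
  have hcbx : ∀ τr : T × Fin 4,
      (cbx τr : ℂ ⊗[ℚ] bettiCohomology A.X 1) = b τr.1 τr.2 := by
    intro τr
    rw [hcbxdef, Module.Basis.reindex_apply, DirectSum.IsInternal.collectedBasis_coe]
    rfl
  have hcbσ : ∀ m, (cbσ m : ℂ ⊗[ℚ] bettiCohomology A.X 1) = b (φ m).1 (φ m).2 := fun m => by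
    rw [hcbσdef, Module.Basis.reindex_apply, Equiv.symm_symm, hcbx]
  -- letters
  set ρ := ofRatClassBaseChangeEquiv hX 1 with hρ
  set v : Module.Basis _ ℂ (complexBetti A.X 1) := cbσ.map ρ with hv
  set eL : Module.Basis _ ℂ (complexBetti A.X 1) := eC.map ρ with heL
  have heLQ : ∀ i, IsRationalClass (eL i) := fun i => by
    rw [heL, Module.Basis.map_apply, heC, Algebra.TensorProduct.basis_apply, hρ,
      ofRatClassBaseChangeEquiv_apply, ofRatClassBaseChange_tmul, one_smul]
    exact isRationalClass_ofRatClass _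
  set κ : Fin (Module.finrank ℚ (bettiCohomology A.X 1)) → Fin 2 := fun m => kd (φ m).2 with hκ
  have hv_apply : ∀ m, v m = ofRatClassBaseChange (Motives.ComplexPoints A.X) 1
      (b (φ m).1 (φ m).2 : ℂ ⊗[ℚ] bettiCohomology A.X 1) := fun m => by
    rw [hv, Module.Basis.map_apply, hcbσ, hρ, ofRatClassBaseChangeEquiv_apply]
  have hv0 : ∀ m, κ m = 0 → IsOfHodgeType A.dim A.X 1 1 0 (v m) := by
    intro m hm
    rw [hv_apply, ← BettiUniverse.mem_hodge_piece_iff hHD hI hX (k := 1) (p := 1) (q := 0) rfl]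
    exact hb0 (φ m).1 (φ m).2 hm
  have hv1 : ∀ m, κ m = 1 → IsOfHodgeType A.dim A.X 1 0 1 (v m) := by
    intro m hm
    rw [hv_apply, ← BettiUniverse.mem_hodge_piece_iff hHD hI hX (k := 1) (p := 0) (q := 1) rfl]
    exact hb1 (φ m).1 (φ m).2 hm
  -- (α) an antisymmetric kind-balanced coefficient function in the adapted letters
  obtain ⟨ax, hax_bal, hax_anti, hcax⟩ := hg.exists_antisymm_kindBalanced_wordEval_eq v κ hv0 hv1 hp hc
  -- the change of letters to the rational letters
  set G : Matrix _ _ ℂ := eC.toMatrix cbσ with hG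
  set G' : Matrix _ _ ℂ := cbσ.toMatrix eC with hG'
  have hG'G : G' * G = 1 := cbσ.toMatrix_mul_toMatrix_flip eC
  have hve : ∀ m, v m = ∑ i, G i m • eL i := fun m => by
    simp only [hv, heL, Module.Basis.map_apply, ← map_smul, ← map_sum]
    congr 1
    exact (eC.sum_toMatrix_smul_self (v := ⇑cbσ) (j := m)).symm
  have hletters : ∀ j m, avLetters g v (j, m) = ∑ i, G i m • avLetters g eL (j, i) :=
    avLetters_baseChange g G hve
  set aE := colourChangeAt (fun _ : Fin n => G) ax with haE
  have haE_anti : IsAntisymm aE := hax_anti.colourChangeAt _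
  have hcaE : wordEval F (avLetters g eL) aE = c := by
    rw [haE, ← wordEval_eq_wordEval_colourChangeAt F (fun _ : Fin n => G) hletters ax, hcax]
  -- rationality of `aE`
  obtain ⟨q, hq⟩ := hg.exists_rat_wordEval_eq eL heLQ hcQ
  obtain ⟨q', -, haEq⟩ := haE_anti.exists_eq_algebraMap_of_wordEval_eq hFinj (hg.letterBasis eL)
    (q := q) (by rw [AVSlots.coe_letterBasis, hcaE, hFdef, hq])
  have hslice_e : ∀ u, wordSlice aE u = wordRepAt ℂ (fun _ : Fin (2 * p) => G) (wordSlice ax u) :=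
    fun u => wordSlice_colourChangeAt (fun _ : Fin n => G) ax u
  -- the Hodge operator `Θ`: `diag(±1)` in the adapted letters
  obtain ⟨Θ, hΘ⟩ := exists_hodgeTheta (BettiUniverse.hodge hHD hX 1)
  have hΘb : ∀ m, Θ (cbσ m) = (if κ m = 0 then (1 : ℂ) else -1) • cbσ m := by
    intro m
    rcases fin2_eq_zero_or_one' (κ m) with h0 | h1
    · rw [if_pos h0, hcbσ]
      have hmem : (b (φ m).1 (φ m).2 : ℂ ⊗[ℚ] bettiCohomology A.X 1) ∈
          (BettiUniverse.hodge hHD hX 1).piece 1 (((1 : ℕ) : ℤ) - 1) := by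
        have e : (((1 : ℕ) : ℤ) - 1) = 0 := by norm_num
        rw [e]; exact hb0 _ _ h0
      rw [hΘ 1 _ hmem]
      norm_num
    · rw [if_neg (by rw [h1]; exact one_ne_zero), hcbσ]
      have hmem : (b (φ m).1 (φ m).2 : ℂ ⊗[ℚ] bettiCohomology A.X 1) ∈
          (BettiUniverse.hodge hHD hX 1).piece 0 (((1 : ℕ) : ℤ) - 0) := by
        have e : (((1 : ℕ) : ℤ) - 0) = 1 := by norm_num
        rw [e]; exact hb1 _ _ h1
      rw [hΘ 0 _ hmem]
      norm_num
  have hΘcb : LinearMap.toMatrix cbσ cbσ Θ = kindDiag κ := by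
    ext i m
    rw [LinearMap.toMatrix_apply, hΘb, map_smul, Module.Basis.repr_self, Finsupp.smul_apply,
      Finsupp.single_apply, kindDiag, Matrix.diagonal_apply, smul_eq_mul, mul_ite, mul_one, mul_zero]
    by_cases him : i = m
    · subst him; rw [if_pos rfl]
    · rw [if_neg (Ne.symm him), if_neg him]
  have hJG : LinearMap.toMatrix eC eC Θ * G = G * kindDiag κ := by
    rw [← hΘcb, hG, linearMap_toMatrix_mul_basis_toMatrix, basis_toMatrix_mul_linearMap_toMatrix]
  have hΘq : ∀ u : Fin (2 * p) → Fin n, wordDerAt ℂ (fun _ : Fin (2 * p) => LinearMap.toMatrix eC eC Θ)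
      (wordSlice (fun w => algebraMap ℚ ℂ (q' w)) u) = 0 := by
    intro u
    rw [← haEq, hslice_e]
    refine wordDerAt_wordRepAt_eq_zero_of_mul_eq ℂ (fun _ : Fin (2 * p) => G) (fun _ => hJG) ?_
    rw [wordDerAt_const]
    exact wordDer_kindDiag_wordSlice_eq_zero κ hax_bal u
  -- the rational Lie algebra `𝔞 ⊆ 𝔰𝔭_F(H¹, ψ)` of the rational tensor `q'`; `Θ ∈ 𝔞_ℂ`
  set 𝔞 : Submodule ℚ (Module.End ℚ (bettiCohomology A.X 1)) := annLie ψ.form eQ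
    (fun a' : (BettiUniverse.hodge hHD hX 1).endAlg => (a' : Module.End ℚ (bettiCohomology A.X 1))) q'
    with h𝔞
  have hΘC : Θ ∈ (BettiUniverse.hodge hHD hX 1).hodgeLieC :=
    (BettiUniverse.hodge hHD hX 1).mem_hodgeLieC_of_forall_piece hΘ
  have hΘ𝔞 : Θ ∈ spanC 𝔞 :=
    mem_spanC_annLie ψ.form eQ _ q' hΘq
      (fun a' => commute_baseChange_of_mem_hodgeLieC (BettiUniverse.hodge hHD hX 1) hΘC a')
      fun x y => by rw [formBaseChange_skew_of_mem_hodgeLieC ψ hΘC, neg_add_cancel]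
  have hbr : ∀ X ∈ 𝔞, ∀ X' ∈ 𝔞, X * X' - X' * X ∈ 𝔞 := fun X hX' X' hX'' =>
    commutator_mem_annLie ψ.form eQ _ q' hX' hX''
  have hcomm : ∀ X ∈ 𝔞, ∀ a' : (BettiUniverse.hodge hHD hX 1).endAlg,
      X * (a' : Module.End ℚ (bettiCohomology A.X 1)) = (a' : Module.End ℚ (bettiCohomology A.X 1)) * X :=
    fun X hX' a' => ((mem_annLie_iff ψ.form eQ _ q' X).1 hX').2.1 a'
  have hskew : ∀ X ∈ 𝔞, ∀ v' w, ψ.form (X v') w + ψ.form v' (X w) = 0 :=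
    fun X hX' => ((mem_annLie_iff ψ.form eQ _ q' X).1 hX').2.2
  -- the coefficient function, refined to slot-and-place colours
  refine ⟨fun w => ax fun t => ((w t).1.1, φ.symm ((w t).1.2, (w t).2)), ?_, fun U τ f hf => ?_⟩
  · rw [← hcax]
    have hx : (fun jr : (Fin n × T) × Fin 4 =>
        avLetters g v (jr.1.1, φ.symm (jr.1.2, jr.2))) =
        fun jr : (Fin n × T) × Fin 4 => complexBetti.map (g jr.1.1).hom.hom.hom 1
          (ofRatClassBaseChange (Motives.ComplexPoints A.X) 1
            (b jr.1.2 jr.2 : ℂ ⊗[ℚ] bettiCohomology A.X 1)) := by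
      funext jr
      rw [avLetters_apply, hv_apply, Equiv.apply_symm_apply]
    rw [← hx]
    exact wordEval_blockLetters F φ (avLetters g v) ax
  · -- an element `Y ∈ 𝔞_ℂ` equal to `f` on `V_τ` and to `0` on the other blocks
    obtain ⟨Y, hY, hYf, hY0⟩ := SpBlocksTheta.exists_mem_spanC_supported (BettiUniverse.hodge hHD hX 1)
      Nat.cast_one heff ψ hself σ hreal hint h4 𝔞 hbr hΘ hΘ𝔞 hcomm hskew τ f hf
    have hL : ∀ u : Fin (2 * p) → Fin n, wordDerAt ℂ (fun _ : Fin (2 * p) => LinearMap.toMatrix eC eC Y)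
        (wordSlice (fun w => algebraMap ℚ ℂ (q' w)) u) = 0 := fun u => by
      rw [h𝔞] at hY
      exact wordDerAt_eq_zero_of_mem_spanC_annLie ψ.form eQ _ q' hY u
    -- `Y` kills the slices of `a_x` (transport through `G`)
    have hkill : ∀ u : Fin (2 * p) → Fin n,
        wordDerAt ℂ (fun _ : Fin (2 * p) => LinearMap.toMatrix cbσ cbσ Y) (wordSlice ax u) = 0 := by
      intro u
      have h1 := hL u
      rw [← haEq, hslice_e] at h1
      have hYG : ∀ _t : Fin (2 * p),
          LinearMap.toMatrix eC eC Y * G = G * LinearMap.toMatrix cbσ cbσ Y := fun _ => by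
        rw [hG, linearMap_toMatrix_mul_basis_toMatrix, basis_toMatrix_mul_linearMap_toMatrix]
      have h3 : wordRepAt ℂ (fun _ : Fin (2 * p) => G)
          (wordDerAt ℂ (fun _ : Fin (2 * p) => LinearMap.toMatrix cbσ cbσ Y) (wordSlice ax u)) = 0 := by
        rw [wordRepAt_wordDerAt_of_mul_eq ℂ (fun _ : Fin (2 * p) => G) hYG, h1]
      exact wordRepAt_injective ℂ (g := fun _ : Fin (2 * p) => G) (g' := fun _ : Fin (2 * p) => G')
        (funext fun _ => hG'G) (by rw [h3, map_zero])
    -- the matrix of `Y` in the block basis: the single block `[f]_{b_τ}` at place `τ`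
    have hblk : ∀ i i', LinearMap.toMatrix cbσ cbσ Y i i' = if (φ i).1 = (φ i').1 then
        (Pi.single τ (LinearMap.toMatrix (b τ) (b τ) f) :
          T → Matrix (Fin 4) (Fin 4) ℂ) (φ i').1 (φ i).2 (φ i').2 else 0 := by
      intro i i'
      rw [LinearMap.toMatrix_apply, hcbσ i']
      by_cases hk : (φ i').1 = τ
      · subst hk
        rw [Pi.single_eq_same, ← hYf]
        have hfx : (((f (b (φ i').1 (φ i').2) : _) : ℂ ⊗[ℚ] bettiCohomology A.X 1)) =
            ∑ a', LinearMap.toMatrix (b (φ i').1) (b (φ i').1) f a' (φ i').2 •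
              cbσ (φ.symm ((φ i').1, a')) := by
          conv_lhs => rw [← (b (φ i').1).sum_repr (f (b (φ i').1 (φ i').2))]
          rw [Submodule.coe_sum]
          refine Finset.sum_congr rfl fun a' _ => ?_
          rw [Submodule.coe_smul, LinearMap.toMatrix_apply, hcbσ, Equiv.apply_symm_apply]
        rw [hfx, map_sum, Finset.sum_apply']
        simp only [map_smul, Module.Basis.repr_self, Finsupp.smul_apply, Finsupp.single_apply,
          smul_eq_mul, mul_ite, mul_one, mul_zero]
        by_cases h : (φ i).1 = (φ i').1
        · rw [if_pos h, Finset.sum_eq_single (φ i).2]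
          · rw [if_pos]; rw [← h, Prod.mk.eta, Equiv.symm_apply_apply]
          · intro a' _ ha'
            rw [if_neg]
            intro hia
            apply ha'
            rw [← hia, Equiv.apply_symm_apply]
          · intro hh; exact absurd (Finset.mem_univ _) hh
        · rw [if_neg h]
          refine Finset.sum_eq_zero fun a' _ => ?_
          rw [if_neg]
          intro hia
          apply h
          rw [← hia, Equiv.apply_symm_apply]
      · rw [hY0 (φ i').1 hk _ (b (φ i').1 (φ i').2).2, map_zero, Finsupp.zero_apply]
        by_cases h : (φ i).1 = (φ i').1
        · rw [if_pos h, Pi.single_eq_of_ne hk, Matrix.zero_apply]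
        · rw [if_neg h]
    exact wordDerAt_place_eq_zero_of_blockEntries φ τ (LinearMap.toMatrix (b τ) (b τ) f) hblk hkill U


/-! ### §2 `B• = D• ⊗ ℂ` from real characters, Hodge–Darboux block bases and rational `θ`-classes -/

open scoped Classical in
/-- **`Bᵖ(B) ⊆ Dᵖ(B) ⊗ ℂ` from real characters with four-dimensional blocks, Hodge–Darboux block bases and
rational symplectic classes** (assembly, verbatim the field case `AVSlots.rm2HodgeClasses_divisorial`: the
invariance theorem of §1, the passage `𝔰𝔭(V_τ) → Sp(V_τ)` place by place
(`wordRepAt_colour_eq_self_of_forall_wordDerAt_sp_eq_zero_neg`, the Gram matrix of a Hodge–Darboux basis being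
`−J`), the coloured tensor FFT with its evaluation (`wordEval_mem_divisorClassesSpan_of_forall_wordRepAt_colour_eq`)
and the crossed classes `sum_gramFourInv_smul_cup_rm4Letters_mem` fed by `hθ`). For `B` with slots over `A`:
every rational `(p,p)`-class on `B` is a `ℂ`-combination of products of `p` rational `(1,1)`-classes.
[cite: MoonenZarhin1995Duke, Type I(2)] [cite: Murty1984, §3] [cite: Ribet1983, Thm. 0] [cite: Hazama1989, Thm. (= Gordon 7.6.2)] -/
theorem AVSlots.hodgeClasses_divisorial_of_sp4BlockBasis [HodgeTensorFacts.{0, 0}] (hg : AVSlots A B g)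
    (hHD : exists_isReal_hodgeModel) (hI : hodgePQ_independent_of_hodgeModel)
    {T : Type} [Fintype T] [DecidableEq T]
    (ψ : (BettiUniverse.hodge hHD (AbelianVariety.isSmoothProjective_holds (A := A)) 1).Polarization)
    (hself : ∀ a : (BettiUniverse.hodge hHD (AbelianVariety.isSmoothProjective_holds (A := A)) 1).endAlg,
      LinearMap.IsAdjointPair ψ.form ψ.form (a : Module.End ℚ (bettiCohomology A.X 1))
        (a : Module.End ℚ (bettiCohomology A.X 1)))
    (σ : T → ((BettiUniverse.hodge hHD (AbelianVariety.isSmoothProjective_holds (A := A)) 1).endAlg →+* ℂ))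
    (hreal : ∀ τ, (starRingEnd ℂ).comp (σ τ) = σ τ)
    (hint : DirectSum.IsInternal fun τ => (BettiUniverse.hodge hHD (AbelianVariety.isSmoothProjective_holds (A := A)) 1).eigenBlock (σ τ))
    (h4 : ∀ τ, Module.finrank ℂ ((BettiUniverse.hodge hHD (AbelianVariety.isSmoothProjective_holds (A := A)) 1).eigenBlock (σ τ)) = 4)
    (b : ∀ τ, Module.Basis (Fin 4) ℂ ((BettiUniverse.hodge hHD (AbelianVariety.isSmoothProjective_holds (A := A)) 1).eigenBlock (σ τ)))
    (hb0 : ∀ τ, (b τ 0 : ℂ ⊗[ℚ] bettiCohomology A.X 1) ∈ (BettiUniverse.hodge hHD (AbelianVariety.isSmoothProjective_holds (A := A)) 1).piece 1 0) (hb1 : ∀ τ, (b τ 1 : ℂ ⊗[ℚ] bettiCohomology A.X 1) ∈ (BettiUniverse.hodge hHD (AbelianVariety.isSmoothProjective_holds (A := A)) 1).piece 1 0)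
    (hb2 : ∀ τ, (b τ 2 : ℂ ⊗[ℚ] bettiCohomology A.X 1) ∈ (BettiUniverse.hodge hHD (AbelianVariety.isSmoothProjective_holds (A := A)) 1).piece 0 1) (hb3 : ∀ τ, (b τ 3 : ℂ ⊗[ℚ] bettiCohomology A.X 1) ∈ (BettiUniverse.hodge hHD (AbelianVariety.isSmoothProjective_holds (A := A)) 1).piece 0 1)
    (h02 : ∀ τ, ψ.form.baseChange ℂ (b τ 0 : ℂ ⊗[ℚ] bettiCohomology A.X 1) (b τ 2) = 1)
    (h13 : ∀ τ, ψ.form.baseChange ℂ (b τ 1 : ℂ ⊗[ℚ] bettiCohomology A.X 1) (b τ 3) = 1)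
    (h01 : ∀ τ, ψ.form.baseChange ℂ (b τ 0 : ℂ ⊗[ℚ] bettiCohomology A.X 1) (b τ 1) = 0)
    (h23 : ∀ τ, ψ.form.baseChange ℂ (b τ 2 : ℂ ⊗[ℚ] bettiCohomology A.X 1) (b τ 3) = 0)
    (h03 : ∀ τ, ψ.form.baseChange ℂ (b τ 0 : ℂ ⊗[ℚ] bettiCohomology A.X 1) (b τ 3) = 0)
    (h12 : ∀ τ, ψ.form.baseChange ℂ (b τ 1 : ℂ ⊗[ℚ] bettiCohomology A.X 1) (b τ 2) = 0)
    (hθ : ∀ τ, cupH1 A (b τ 0 : ℂ ⊗[ℚ] bettiCohomology A.X 1) (b τ 2) + cupH1 A (b τ 1 : ℂ ⊗[ℚ] bettiCohomology A.X 1) (b τ 3) ∈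
      Submodule.span ℂ {c : complexBetti A.X 2 | IsRationalClass c ∧ IsOfHodgeType A.dim A.X 2 1 1 c})
    (p : ℕ) (c : complexBetti B.X (2 * p)) (hcQ : IsRationalClass c)
    (hc : IsOfHodgeType B.dim B.X (2 * p) p p c) :
    c ∈ divisorClassesSpan B.X B.dim p := by
  classical
  rcases Nat.eq_zero_or_pos p with rfl | hp
  · exact AbelianVariety.mem_divisorClassesSpan_zero B c
  haveI : Module.Finite ℚ (bettiCohomology A.X 1) := finite_bettiCohomology_one A
  have hX : IsSmoothProjective A.dim A.X := AbelianVariety.isSmoothProjective_holds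
  -- the Lie step: slices killed by `𝔰𝔭(V_τ)` at place `τ`
  set kd : Fin 4 → Fin 2 := ![0, 0, 1, 1] with hkd
  have hkd0 : ∀ τ (r : Fin 4), kd r = 0 → (b τ r : ℂ ⊗[ℚ] bettiCohomology A.X 1) ∈
      (BettiUniverse.hodge hHD hX 1).piece 1 0 := by
    intro τ r hr
    fin_cases r
    · exact hb0 τ
    · exact hb1 τ
    · exact absurd hr (by simp [hkd])
    · exact absurd hr (by simp [hkd])
  have hkd1 : ∀ τ (r : Fin 4), kd r = 1 → (b τ r : ℂ ⊗[ℚ] bettiCohomology A.X 1) ∈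
      (BettiUniverse.hodge hHD hX 1).piece 0 1 := by
    intro τ r hr
    fin_cases r
    · exact absurd hr (by simp [hkd])
    · exact absurd hr (by simp [hkd])
    · exact hb2 τ
    · exact hb3 τ
  obtain ⟨a, hca, hkill⟩ :=
    hg.exists_sp4Invariant_coeff_of_real_characters hHD hI ψ hself σ hreal hint h4 b kd hkd0 hkd1 hp hcQ hc
  rw [← hca]
  -- the Gram matrix of every block basis is `G = ( 0 I ; -I 0 ) = -J`
  set G : Matrix (Fin 4) (Fin 4) ℂ := !![0, 0, 1, 0; 0, 0, 0, 1; -1, 0, 0, 0; 0, -1, 0, 0] with hG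
  have hodd : Odd (((1 : ℕ) : ℤ)) := ⟨0, by norm_num⟩
  have hgram : ∀ τ, Matrix.of (fun a' c' : Fin 4 => ψ.form.baseChange ℂ (b τ a' : ℂ ⊗[ℚ] bettiCohomology A.X 1)
      (b τ c')) = G := by
    intro τ
    have hself0 : ∀ a' : Fin 4, ψ.form.baseChange ℂ (b τ a' : ℂ ⊗[ℚ] bettiCohomology A.X 1) (b τ a') = 0 :=
      fun a' => form_baseChange_self_eq_zero_of_odd (BettiUniverse.hodge hHD hX 1) hodd ψ _
    have hswap : ∀ a' c' : Fin 4, ψ.form.baseChange ℂ (b τ c' : ℂ ⊗[ℚ] bettiCohomology A.X 1) (b τ a') =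
        -ψ.form.baseChange ℂ (b τ a' : ℂ ⊗[ℚ] bettiCohomology A.X 1) (b τ c') := fun a' c' =>
      form_baseChange_swap_of_odd (BettiUniverse.hodge hHD hX 1) hodd ψ _ _
    have h20 := hswap 0 2; have h31 := hswap 1 3; have h10 := hswap 0 1; have h32 := hswap 2 3
    have h30 := hswap 0 3; have h21 := hswap 1 2
    rw [h02] at h20; rw [h13] at h31; rw [h01] at h10; rw [h23] at h32; rw [h03] at h30; rw [h12] at h21
    ext a' c'
    rw [Matrix.of_apply, hG]
    fin_cases a' <;> fin_cases c' <;>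
      simp [hself0, h02, h13, h01, h23, h03, h12, h20, h31, h10, h32, h30, h21]
  -- the coloured `Sp`-invariance of the slices (Lie algebra → group, place by place)
  have hinv : ∀ (U : Fin (2 * p) → Fin n × T) (τ : T)
      (g' : Matrix (Fin 4) (Fin 4) ℂ), g'ᵀ * G * g' = G →
      wordRepAt ℂ (fun q => if (Prod.snd ∘ U) q = τ then g' else 1) (wordSlice a U) = wordSlice a U := by
    intro U τ g' hg'
    rw [hG, gramFour_eq_neg_reindex_J] at hg'
    refine wordRepAt_colour_eq_self_of_forall_wordDerAt_sp_eq_zero_neg (l := Fin 2) (n := 4) finSumFinEquiv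
      (Prod.snd ∘ U) τ (fun X hX => ?_) hg'
    rw [← gramFour_eq_neg_reindex_J, ← hG, ← hgram τ] at hX
    have hf := add_eq_zero_of_transpose_mul_gram (ψ.form.baseChange ℂ) (b τ) hX
    have h := hkill U τ (Matrix.toLin (b τ) (b τ) X) hf
    rw [LinearMap.toMatrix_toLin] at h
    exact h
  -- the symplectic classes and the coloured tensor FFT
  refine wordEval_mem_divisorClassesSpan_of_forall_wordRepAt_colour_eq
    (fun jr : (Fin n × T) × Fin 4 => complexBetti.map (g jr.1.1).hom.hom.hom 1
      (ofRatClassBaseChange (Motives.ComplexPoints A.X) 1 (b jr.1.2 jr.2 : ℂ ⊗[ℚ] bettiCohomology A.X 1)))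
    Prod.snd (fun _ => G) (fun _ => by rw [hG]; exact gramFour_isAlt) (fun _ => by rw [hG]; exact gramFour_nondegenerate)
    (fun s s' hss' => ?_) a hinv
  rw [hG]
  exact sum_gramFourInv_smul_cup_rm4Letters_mem g b hθ s s' hss'

/-- **`IsDivisorGenerated B`** for every abelian variety `B` with slots over an abelian variety `A` carrying the data
of `hodgeClasses_divisorial_of_sp4BlockBasis` (the tree's spelling of `B•(B) = D•(B) ⊗ ℂ`).
[cite: MoonenZarhin1995Duke, Type I(2)] [cite: Murty1984, §3] [cite: Hazama1989, Thm. (= Gordon 7.6.2)] -/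
theorem AVSlots.isDivisorGenerated_of_sp4BlockBasis [HodgeTensorFacts.{0, 0}] (hg : AVSlots A B g)
    (hHD : exists_isReal_hodgeModel) (hI : hodgePQ_independent_of_hodgeModel)
    {T : Type} [Fintype T] [DecidableEq T]
    (ψ : (BettiUniverse.hodge hHD (AbelianVariety.isSmoothProjective_holds (A := A)) 1).Polarization)
    (hself : ∀ a : (BettiUniverse.hodge hHD (AbelianVariety.isSmoothProjective_holds (A := A)) 1).endAlg,
      LinearMap.IsAdjointPair ψ.form ψ.form (a : Module.End ℚ (bettiCohomology A.X 1))
        (a : Module.End ℚ (bettiCohomology A.X 1)))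
    (σ : T → ((BettiUniverse.hodge hHD (AbelianVariety.isSmoothProjective_holds (A := A)) 1).endAlg →+* ℂ))
    (hreal : ∀ τ, (starRingEnd ℂ).comp (σ τ) = σ τ)
    (hint : DirectSum.IsInternal fun τ => (BettiUniverse.hodge hHD (AbelianVariety.isSmoothProjective_holds (A := A)) 1).eigenBlock (σ τ))
    (h4 : ∀ τ, Module.finrank ℂ ((BettiUniverse.hodge hHD (AbelianVariety.isSmoothProjective_holds (A := A)) 1).eigenBlock (σ τ)) = 4)
    (b : ∀ τ, Module.Basis (Fin 4) ℂ ((BettiUniverse.hodge hHD (AbelianVariety.isSmoothProjective_holds (A := A)) 1).eigenBlock (σ τ)))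
    (hb0 : ∀ τ, (b τ 0 : ℂ ⊗[ℚ] bettiCohomology A.X 1) ∈ (BettiUniverse.hodge hHD (AbelianVariety.isSmoothProjective_holds (A := A)) 1).piece 1 0) (hb1 : ∀ τ, (b τ 1 : ℂ ⊗[ℚ] bettiCohomology A.X 1) ∈ (BettiUniverse.hodge hHD (AbelianVariety.isSmoothProjective_holds (A := A)) 1).piece 1 0)
    (hb2 : ∀ τ, (b τ 2 : ℂ ⊗[ℚ] bettiCohomology A.X 1) ∈ (BettiUniverse.hodge hHD (AbelianVariety.isSmoothProjective_holds (A := A)) 1).piece 0 1) (hb3 : ∀ τ, (b τ 3 : ℂ ⊗[ℚ] bettiCohomology A.X 1) ∈ (BettiUniverse.hodge hHD (AbelianVariety.isSmoothProjective_holds (A := A)) 1).piece 0 1)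
    (h02 : ∀ τ, ψ.form.baseChange ℂ (b τ 0 : ℂ ⊗[ℚ] bettiCohomology A.X 1) (b τ 2) = 1)
    (h13 : ∀ τ, ψ.form.baseChange ℂ (b τ 1 : ℂ ⊗[ℚ] bettiCohomology A.X 1) (b τ 3) = 1)
    (h01 : ∀ τ, ψ.form.baseChange ℂ (b τ 0 : ℂ ⊗[ℚ] bettiCohomology A.X 1) (b τ 1) = 0)
    (h23 : ∀ τ, ψ.form.baseChange ℂ (b τ 2 : ℂ ⊗[ℚ] bettiCohomology A.X 1) (b τ 3) = 0)
    (h03 : ∀ τ, ψ.form.baseChange ℂ (b τ 0 : ℂ ⊗[ℚ] bettiCohomology A.X 1) (b τ 3) = 0)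
    (h12 : ∀ τ, ψ.form.baseChange ℂ (b τ 1 : ℂ ⊗[ℚ] bettiCohomology A.X 1) (b τ 2) = 0)
    (hθ : ∀ τ, cupH1 A (b τ 0 : ℂ ⊗[ℚ] bettiCohomology A.X 1) (b τ 2) + cupH1 A (b τ 1 : ℂ ⊗[ℚ] bettiCohomology A.X 1) (b τ 3) ∈
      Submodule.span ℂ {c : complexBetti A.X 2 | IsRationalClass c ∧ IsOfHodgeType A.dim A.X 2 1 1 c}) :
    IsDivisorGenerated B :=
  fun p c hcQ hc => hg.hodgeClasses_divisorial_of_sp4BlockBasis hHD hI ψ hself σ hreal hint h4 b hb0 hb1 hb2 hb3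
    h02 h13 h01 h23 h03 h12 hθ p c hcQ hc


end Literature.AlgebraicGeometry.HodgeTheory

end
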